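import Summits.HubbardSuperconductivity.HubbardSuperconductivity.Theorems.KLProgrammeKLRegimeScaleZeroCovarianceFarSitesFreqSum
import Summits.HubbardSuperconductivity.HubbardSuperconductivity.Theorems.KLProgrammeKLRegimeScaleZeroCovarianceFarSitesRingSum
import Summits.HubbardSuperconductivity.HubbardSuperconductivity.Theorems.KLProgrammeKLRegimeScaleZeroCovarianceOffSiteSpatialEnvelope

/-!
# Route `KLProgramme`, crux K3 — engine-flow child (stmt-HubbardSuperconductivity-20437), stub (C) at `n = 0`, located gap «(2e)-FAR-SITES» (pen (R196)),
# (F-c)+(F-d)+(F-e) COMBINED: the far-site sum of the moment-weighted, frequency-summed squared torus factors, from ONE certified envelope number `Jm`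

Cell gate-hubbard-kl, seat p1 g21.  For the TIME-PARSEVAL route of k3c5-p1's FAR-SITES-NOTE-g14 §4: after (F-a) Gram and (F-b) Parseval, the far rows need
`Σ_{x₁ : ‖z_c‖_∞ > Rc} w_k(z_c)·Σ_{i : MatsubaraIdx M} ‖H_{z_c}(ω_i)‖²` with `z_c = valMinAbs(x₁ − x₀)` the centred representative (`proj z_c = x₁ − x₀`, `2‖z_c‖ ≤ L`),
`H_z(ω) = L⁻²Σ_k χ_k(z̄)Ψ¹(ω, e_K(2πk/L))`, `w_k = √(z₀²+z₁²)^k`.  From the envelope `∀ ω ≠ 0, ∀ y, ‖Dᵐg_ω(y)‖ ≤ Jm/max(|ω|,Λ/2)`: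

* **`sum_farSites_weight_mul_sum_norm_sq_le_of_envelope`** — for `m ≥ 4`, `k + 4 ≤ 2m`, every `Rc`, `x₀`, `0 < β`, `0 < Λ`:
  `Σ_{x₁} [Rc < ‖z_c‖_∞]·√(z_c,0²+z_c,1²)^k·Σ_i ‖H_{z_c}(ω_i)‖² ≤ β·(2/Λ)·(Jm(1+4ᵐS_m)/π^m)²·9·2^k·(1+Rc)^{−(2m−k−4)}` — β enters only as the row currency
  (`c_i = (1/β)·phase·H` turns it into `1/β`), uniform in `M`, `L`, `μ` (through `Jm`).

Proofs only; no definitions; nothing here asserts (C), any stub of 20437, K3 or superconductivity; `Jm` is an INPUT certified kit-side under a named hypothesis.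
References: BGM 2006 §2.1–§2.4 [cite: BenfattoGiulianiMastropietro2006].
-/

noncomputable section

namespace Summit.HubbardSuperconductivity.HubbardSuperconductivity.Theorems.KLRegimeSplit

set_option linter.dupNamespace false -- summit = problem name (single-conjunct summit), D-0017

open Literature.MathematicalPhysics.QuantumLattice Literature.Probability.LatticeModels Literature.Analysis.FunctionSpaces
open Summit.HubbardSuperconductivity.HubbardSuperconductivity.Theorems.DispersionFlow
open Finset Real

variable {L : ℕ} [NeZero L]

/-- **THE FAR BLOCK from one envelope number.**  See the module docstring. -/
theorem sum_farSites_weight_mul_sum_norm_sq_le_of_envelope {β : ℝ} (hβ : 0 < β) (M : ℕ) {Λ : ℝ} (hΛ : 0 < Λ) (μ : ℝ) (K : TrigPolyC4v) {m k : ℕ}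
    (hm : 2 * 2 ≤ m) (hkm : k + 4 ≤ 2 * m) {Jm : ℝ} (hJm : 0 ≤ Jm)
    (hJ : ∀ om : ℝ, om ≠ 0 → ∀ y : Momentum,
      ‖iteratedFDeriv ℝ m (fun y : Momentum => uvSymbolFn 1 Λ (frameLevel μ K ((2 * π) • y)) om) y‖ ≤ Jm / max |om| (Λ / 2))
    (x₀ : TorusSite 2 L) (Rc : ℕ) :
    ∑ x₁ : TorusSite 2 L, (if (Rc : ℝ) < ‖(fun j => ((x₁ - x₀) j).valMinAbs : Site 2)‖ then
        Real.sqrt (((((fun j => ((x₁ - x₀) j).valMinAbs : Site 2) 0 : ℤ) : ℝ)) ^ 2 + ((((fun j => ((x₁ - x₀) j).valMinAbs : Site 2) 1 : ℤ) : ℝ)) ^ 2) ^ k *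
          ∑ i : MatsubaraIdx M, ‖torusFourierInv (fun kv : TorusSite 2 L =>
            (fun y : Momentum => uvSymbolFn 1 Λ (frameLevel μ K ((2 * π) • y)) (matsubaraFreq β M i)) (WithLp.toLp 2 fun i => ((kv i).val : ℝ) / L))
            (Torus.proj L (fun j => ((x₁ - x₀) j).valMinAbs : Site 2))‖ ^ 2 else 0) ≤
      β * (2 / Λ) * (Jm * (1 + (4 : ℝ) ^ m * ∑' n : Site 2, ((1 + ‖n‖) ^ m)⁻¹) / Real.pi ^ m) ^ 2 * (9 * 2 ^ k * ((1 + (Rc : ℝ)) ^ (2 * m - k - 4))⁻¹) := by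
  set zc : TorusSite 2 L → Site 2 := fun x₁ => fun j => ((x₁ - x₀) j).valMinAbs with hzc
  set Cst : ℝ := β * (2 / Λ) * (Jm * (1 + (4 : ℝ) ^ m * ∑' n : Site 2, ((1 + ‖n‖) ^ m)⁻¹) / Real.pi ^ m) ^ 2 with hCst
  have hS0 : 0 ≤ ∑' n : Site 2, ((1 + ‖n‖) ^ m)⁻¹ := tsum_nonneg fun _ => by positivity
  have hCst0 : 0 ≤ Cst := by rw [hCst]; positivity
  -- termwise: on the far ring `z_c ≠ 0`, so (F-d) applies with the centred representative
  have hterm : ∀ x₁ : TorusSite 2 L, (if (Rc : ℝ) < ‖zc x₁‖ then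
      Real.sqrt ((((zc x₁ 0 : ℤ) : ℝ)) ^ 2 + (((zc x₁ 1 : ℤ) : ℝ)) ^ 2) ^ k *
        ∑ i : MatsubaraIdx M, ‖torusFourierInv (fun kv : TorusSite 2 L =>
          (fun y : Momentum => uvSymbolFn 1 Λ (frameLevel μ K ((2 * π) • y)) (matsubaraFreq β M i)) (WithLp.toLp 2 fun i => ((kv i).val : ℝ) / L))
          (Torus.proj L (zc x₁))‖ ^ 2 else 0) ≤
      Cst * (if (Rc : ℝ) < ‖zc x₁‖ then Real.sqrt ((((zc x₁ 0 : ℤ) : ℝ)) ^ 2 + (((zc x₁ 1 : ℤ) : ℝ)) ^ 2) ^ k * (((1 + ‖zc x₁‖) ^ m)⁻¹) ^ 2 else 0) := by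
    intro x₁
    split_ifs with hfar
    · obtain ⟨hproj, hzL⟩ := two_mul_norm_valMinAbs_le (L := L) (x₁ - x₀)
      have hz0 : Torus.proj L (zc x₁) ≠ 0 := by
        intro h0
        have hx : x₁ - x₀ = 0 := by rw [← hproj]; exact h0
        have : zc x₁ = 0 := by
          funext j
          show ((x₁ - x₀) j).valMinAbs = 0
          rw [hx]; simp
        rw [this, norm_zero] at hfar
        exact absurd hfar (by have : (0 : ℝ) ≤ Rc := Nat.cast_nonneg _; linarith)
      have hsum := sum_matsubaraIdx_norm_sq_torusFactor_le_of_envelope (L := L) hβ M hΛ μ K hm hJm hJ hzL hz0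
      have hw0 : 0 ≤ Real.sqrt ((((zc x₁ 0 : ℤ) : ℝ)) ^ 2 + (((zc x₁ 1 : ℤ) : ℝ)) ^ 2) ^ k := by positivity
      calc _ ≤ Real.sqrt ((((zc x₁ 0 : ℤ) : ℝ)) ^ 2 + (((zc x₁ 1 : ℤ) : ℝ)) ^ 2) ^ k * (Cst * (((1 + ‖zc x₁‖) ^ m)⁻¹) ^ 2) :=
            mul_le_mul_of_nonneg_left hsum hw0
        _ = _ := by ring
    · simp
  calc _ ≤ ∑ x₁ : TorusSite 2 L, Cst * (if (Rc : ℝ) < ‖zc x₁‖ then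
          Real.sqrt ((((zc x₁ 0 : ℤ) : ℝ)) ^ 2 + (((zc x₁ 1 : ℤ) : ℝ)) ^ 2) ^ k * (((1 + ‖zc x₁‖) ^ m)⁻¹) ^ 2 else 0) :=
        Finset.sum_le_sum fun x₁ _ => hterm x₁
    _ = Cst * ∑ x₁ : TorusSite 2 L, (if (Rc : ℝ) < ‖zc x₁‖ then
          Real.sqrt ((((zc x₁ 0 : ℤ) : ℝ)) ^ 2 + (((zc x₁ 1 : ℤ) : ℝ)) ^ 2) ^ k * (((1 + ‖zc x₁‖) ^ m)⁻¹) ^ 2 else 0) := by rw [Finset.mul_sum]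
    _ ≤ Cst * (9 * 2 ^ k * ((1 + (Rc : ℝ)) ^ (2 * m - k - 4))⁻¹) :=
        mul_le_mul_of_nonneg_left (sum_torusSite_farRing_le (L := L) x₀ hkm Rc) hCst0

end Summit.HubbardSuperconductivity.HubbardSuperconductivity.Theorems.KLRegimeSplit

end
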